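import Literature.MathematicalPhysics.QuantumFieldTheory.TwistedPartitionFunction
import Literature.MathematicalPhysics.QuantumFieldTheory.ConstructiveQFTWave0SiteRPProofs
import HarnessLib

/-!
# The twisted partition function is bounded by the untwisted one (Tomboulis–Yaffe / Kanazawa)

For Wilson's lattice gauge theory on the torus `(ℤ/Lℤ)^d`, `L` even, with a compact gauge group
`G`, a continuous matrix representation `ρ` and ANY real `β`, 't Hooft's twisted partition
function `Z_{β,L}(z; q)` of
`Literature.MathematicalPhysics.QuantumFieldTheory.twistedPartitionFunction`
(central twist `z` on a coclosed stack of plaquettes of the plane `q`) satisfies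

  `Z_{β,L}(z; q) ≤ Z_{β,L}(1; q)`      (`twistedPartitionFunction_le_untwisted_plane`),

i.e. the vortex free energy `-log (Z(z)/Z(1))` is non-negative, for every plane `q`: first for the
planes `q = (0, ν)` containing the `0`-axis (`twistedPartitionFunction_le_untwisted`; `0` is the
reflection direction of the site-reflection-positivity theorem
`wilsonExpectation_siteReflectionPositive` of this tree), then for all planes by a relabelling of
the axes (section `AllPlanes`).

This is the item recorded as "Not here" in `TwistedPartitionFunction.lean` ("the transfer-matrix
bound `Z(z; q) ≤ Z(1; q)` (reflection positivity)").

## Source and proof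

T. Kanazawa, *Generalizing the Tomboulis–Yaffe inequality to SU(N) lattice gauge theories and
general classical spin systems*, Ann. Phys. 324 (2009) 1634–1665 (arXiv:0808.3442), §2, Lemma 2,
eq. (17) (arXiv numbering): `0 ≤ ⟨𝒪^{[k]}[𝒱]⟩ ≤ 1` where `⟨𝒪^{[k]}[𝒱]⟩ = Z^{[k]}_Λ / Z_Λ` (eq. (8)),
proved there by reflection positivity in a hyperplane through SITES ("we never use
link-reflections"), the Schwarz inequality `|⟨F⟩| ≤ ⟨F θF⟩^{1/2}`, `θ[𝒪^{[k]}[𝒱]] = 𝒪^{[-k]}[𝒱^θ]`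
(eq. (15)) and `⟨𝒪^{[k]}[𝒱] 𝒪^{[-k]}[𝒱^θ]⟩ = ⟨𝒪^{[0]}[𝒱]⟩ = 1` (Lemma 1, eq. (11): two opposite
twists on homologous stacks cancel by a change of variables). The source states it for `G = SU(N)`,
`z = e^{2πik/N}`; its proof uses only that `z` is central and that the Wilson weight is site-
reflection positive, and is carried out here for any compact `G`, central `z`, continuous `ρ` and
real `β`. For `SU(2)` this is the input of the Tomboulis–Yaffe inequality (E. T. Tomboulis,
L. G. Yaffe, Comm. Math. Phys. 100 (1985) 313) and proposition IV.1, eq. (4.5), of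
E. T. Tomboulis, arXiv:0707.2179 (there for non-negative character coefficients, by reflection in
planes without sites).

We follow Kanazawa's three steps literally, in the un-normalised form (integrals against the
product Haar measure `∏ₑ dU_e`, no division by `Z`):
* `F(U) = exp(-β S_z(U)) / exp(-β S_1(U))` is a bounded measurable observable of the four links of
  the stack plaquettes, which for the stack `{x_0 = 0, x_ν = 0}` lie in the closed positive half
  `0 ≤ t ≤ L/2` of the site reflection `θ' t = -t` (the stack plaquettes are
  `WilsonSiteRP.IsSitePosPlaq`);
* `F ∘ Θ'` is the same observable for the twist `z⁻¹` on the reflected stack `{x_0 = -1, x_ν = 0}`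
  (`insertedWilsonAction_stack_negReflect`: the reflected temporal holonomy is a conjugate of the
  inverse, `Re tr ρ(z h⁻¹) = Re tr ρ(z⁻¹ h)`);
* the two opposite stacks cancel: `Z_{z on {x_0=0}, z⁻¹ on {x_0=-1}} = Z(1)`
  (`insertedPartitionFunction_stack_mul_inv_stack`, one coboundary move of
  `TwistedPartitionFunction.stackInsertion_mul_coboundary_fst`);
* site reflection positivity (`WilsonSiteRP.integral_siteIntegrand_nonneg`) applied to the real
  observable `Z(1)·F - Z(z)` gives `0 ≤ Z(1)³ - Z(1) Z(z)²`, whence `Z(z) ≤ Z(1)` (`Z(1) > 0`).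

No sign condition on `β` and no `L ≥ 4`: `L` even (and `L ≠ 0`) suffices, exactly as for the
site-reflection-positivity theorem used.

## Not here

The electric-flux free energy (Kanazawa's (18)), the strict inequality `Z(z; q) < Z(1; q)`, and the
Tomboulis–Yaffe inequality itself (Kanazawa's Theorem 2).
-/

open MeasureTheory Finset Complex
open scoped ComplexConjugate ComplexOrder

namespace Literature.MathematicalPhysics.QuantumFieldTheory

noncomputable section

open WilsonRP WilsonSiteRP

/-! ## Algebra of stack insertions -/

section Algebra

variable {d L : ℕ} {G : Type*} [Group G]

/-- A `z`-stack times a `z⁻¹`-stack at the same place is the trivial insertion. [folklore] -/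
private theorem stackInsertion_mul_stackInsertion_inv (z : G)
    (q : {p : Fin d × Fin d // p.1 < p.2}) (a b : ZMod L) (p : Plaquette d L) :
    stackInsertion z q a b p * stackInsertion z⁻¹ q a b p = 1 := by
  unfold stackInsertion
  split_ifs <;> simp

/-- The site reflection `θ'` (time `t ↦ -t`) carries the stack `{x_0 = a, x_ν = b}` of the plane
`(0, ν)` to the stack `{x_0 = -(a+1), x_ν = b}` and inverts the twist: for every plaquette `p`,
the `z⁻¹`-stack at `-(a+1)` evaluated at the reflected plaquette is the inverse of the `z`-stack at
`a` evaluated at `p`. [folklore] -/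
private theorem stackInsertion_inv_sitePlaqReflect [NeZero d] (z : G) (ν : Fin d)
    (hν : (0 : Fin d) < ν) (a b : ZMod L) (p : Plaquette d L) :
    stackInsertion z⁻¹ ⟨(0, ν), hν⟩ (-(a + 1)) b (sitePlaqReflect p) =
      (stackInsertion z ⟨(0, ν), hν⟩ a b p)⁻¹ := by
  obtain ⟨x, ⟨⟨i, j⟩, hij⟩⟩ := p
  have hν0 : ν ≠ 0 := fun h => (lt_irrefl (0 : Fin d)) (h ▸ hν)
  simp only [stackInsertion, sitePlaqReflect, Subtype.mk.injEq, Prod.mk.injEq]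
  by_cases hi : i = 0
  · subst hi
    simp only [↓reduceIte, true_and, negReflect_apply_zero, shift_apply_self, neg_inj,
      add_left_inj]
    rw [negReflect_apply_of_ne _ hν0, shift_apply_of_ne _ hν0]
    split_ifs <;> simp
  · simp [hi]

/-- **Reflection of a twisted holonomy.** For the site reflection `Θ'` (`t ↦ -t`) and a central
`z`-stack of the plane `(0, ν)` at `{x_0 = a, x_ν = b}`:
`Re tr ρ(t(p) (Θ'U)_p) = Re tr ρ(t'(ϑ'p) U_{ϑ'p})` with `t'` the `z⁻¹`-stack at
`{x_0 = -(a+1), x_ν = b}`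
and `ϑ'` the reflection of plaquettes (the reflected temporal holonomy is a conjugate of the
inverse of the holonomy of the reflected plaquette, and `Re tr ρ(z h⁻¹) = Re tr ρ(z⁻¹ h)` for a
compact group). [folklore] -/
private theorem re_trace_stack_holonomy_negReflect [NeZero d] {N : ℕ} [TopologicalSpace G]
    [IsTopologicalGroup G] [CompactSpace G] (ρ : G →* Matrix (Fin N) (Fin N) ℂ) (hρ : Continuous ρ)
    {z : G} (hz : z ∈ Subgroup.center G) (ν : Fin d) (hν : (0 : Fin d) < ν) (a b : ZMod L)
    (U : GaugeConfig d L G) (p : Plaquette d L) :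
    (ρ (stackInsertion z ⟨(0, ν), hν⟩ a b p *
        plaquetteHolonomy U.negReflect p.1 p.2.1.1 p.2.1.2)).trace.re =
      (ρ (stackInsertion z⁻¹ ⟨(0, ν), hν⟩ (-(a + 1)) b (sitePlaqReflect p) *
        plaquetteHolonomy U (sitePlaqReflect p).1 (sitePlaqReflect p).2.1.1
          (sitePlaqReflect p).2.1.2)).trace.re := by
  rw [stackInsertion_inv_sitePlaqReflect]
  obtain ⟨x, ⟨⟨i, j⟩, hij⟩⟩ := p
  have hj : j ≠ 0 := plaq_snd_ne_zero (x, ⟨(i, j), hij⟩)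
  by_cases hi : i = 0
  · subst hi
    have hc : stackInsertion z ⟨(0, ν), hν⟩ a b (x, ⟨(0, j), hij⟩) ∈ Subgroup.center G := by
      unfold stackInsertion
      split_ifs
      exacts [hz, Subgroup.one_mem _]
    generalize stackInsertion z ⟨(0, ν), hν⟩ a b (x, ⟨(0, j), hij⟩) = c at hc ⊢
    have hcomm : ∀ g : G, g * c = c * g := fun g => Subgroup.mem_center_iff.1 hc g
    have hcomm' : ∀ g : G, g * c⁻¹ = c⁻¹ * g := fun g =>
      Subgroup.mem_center_iff.1 (Subgroup.inv_mem _ hc) g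
    have key : ∀ g h k l : G,
        c * (g⁻¹ * l * k⁻¹⁻¹ * h⁻¹) = g⁻¹ * ((g * h * k⁻¹ * l⁻¹) * c⁻¹)⁻¹ * g⁻¹⁻¹ := by
      intro g h k l
      calc c * (g⁻¹ * l * k⁻¹⁻¹ * h⁻¹) = (c * g⁻¹) * (l * k * h⁻¹) := by group
        _ = (g⁻¹ * c) * (l * k * h⁻¹) := by rw [hcomm]
        _ = g⁻¹ * ((g * h * k⁻¹ * l⁻¹) * c⁻¹)⁻¹ * g⁻¹⁻¹ := by group
    unfold sitePlaqReflect plaquetteHolonomy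
    simp only [negReflect_apply, siteEdgeReflect, hj, ↓reduceIte]
    rw [negReflect_shift_shift_zero _ hj, ← negReflect_shift_shift x, key,
      Literature.RepresentationTheory.CompactGroups.CompactGroup.trace_conj_eq,
      Literature.RepresentationTheory.CompactGroups.CompactGroup.re_trace_map_inv ρ hρ, hcomm']
  · have h1 : ∀ (w : G) (a' : ZMod L) (y : Site d L),
        stackInsertion w ⟨(0, ν), hν⟩ a' b (y, ⟨(i, j), hij⟩) = 1 := by
      intro w a' y
      unfold stackInsertion
      simp [hi]
    unfold sitePlaqReflect plaquetteHolonomy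
    simp only [negReflect_apply, siteEdgeReflect, hj, hi, ↓reduceIte, h1, one_mul, inv_one]
    rw [negReflect_shift_of_ne _ hi, negReflect_shift_of_ne _ hj]

/-- Two stacks of the same plane at different heights `a ≠ a'` are disjoint, so their inserted
actions add up: `S_t + S_{t'} = S_{t t'} + S_1`. [folklore] -/
private theorem insertedWilsonAction_stack_add_stack [NeZero L] {N : ℕ}
    (ρ : G →* Matrix (Fin N) (Fin N) ℂ) (z z' : G) (q : {p : Fin d × Fin d // p.1 < p.2})
    {a a' : ZMod L} (haa' : a ≠ a') (b : ZMod L) (U : GaugeConfig d L G) :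
    insertedWilsonAction ρ (stackInsertion z q a b) U +
        insertedWilsonAction ρ (stackInsertion z' q a' b) U =
      insertedWilsonAction ρ (fun p => stackInsertion z q a b p * stackInsertion z' q a' b p) U +
        insertedWilsonAction ρ (fun _ => (1 : G)) U := by
  unfold insertedWilsonAction
  rw [← Finset.sum_add_distrib, ← Finset.sum_add_distrib]
  refine Finset.sum_congr rfl fun p _ => ?_
  unfold stackInsertion
  by_cases h : p.2 = q ∧ p.1 q.1.1 = a ∧ p.1 q.1.2 = b
  · obtain ⟨hq, ha, hb⟩ := h
    simp [hq, ha, hb, haa']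
  · simp only [h, ↓reduceIte, one_mul]
    ring

end Algebra

/-! ## Reflection and cancellation of stacks -/

section Stacks

variable {d L N : ℕ} [NeZero d] [NeZero L] {G : Type*} [Group G] [TopologicalSpace G]
  [IsTopologicalGroup G] [CompactSpace G] (ρ : G →* Matrix (Fin N) (Fin N) ℂ)

/-- **Reflection reverses the twist** (Kanazawa 2009, Lemma 2, eq. (15):
`θ[𝒪^{[k]}[𝒱]] = 𝒪^{[-k]}[𝒱^θ]`, "obvious from the fact that the orientation of plaquettes are
reversed by reflection"): for the site reflection `Θ'` (`t ↦ -t`) the `z`-twisted action of the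
reflected configuration, twist on the stack `{x_0 = a, x_ν = b}` of the plane `(0, ν)`, is the
`z⁻¹`-twisted action of the configuration with the twist on the reflected stack
`{x_0 = -(a+1), x_ν = b}` (central `z`, continuous `ρ`, compact `G`).
[cite: Kanazawa2008, §2 Lemma 2 eq. (15)] -/
theorem insertedWilsonAction_stack_negReflect (hρ : Continuous ρ) {z : G}
    (hz : z ∈ Subgroup.center G) (ν : Fin d) (hν : (0 : Fin d) < ν) (a b : ZMod L)
    (U : GaugeConfig d L G) :
    insertedWilsonAction ρ (stackInsertion z ⟨(0, ν), hν⟩ a b) U.negReflect =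
      insertedWilsonAction ρ (stackInsertion z⁻¹ ⟨(0, ν), hν⟩ (-(a + 1)) b) U := by
  unfold insertedWilsonAction
  simp_rw [re_trace_stack_holonomy_negReflect ρ hρ hz ν hν a b U]
  exact Finset.sum_equiv sitePlaqReflectEquiv (fun p => by simp) (fun p _ => rfl)

/-- The Wilson action is reflection invariant: `S(Θ'U) = S(U)`. [folklore] -/
private theorem wilsonAction_negReflect (hρ : Continuous ρ) (ν : Fin d) (hν : (0 : Fin d) < ν)
    (U : GaugeConfig d L G) : wilsonAction ρ U.negReflect = wilsonAction ρ U := by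
  have h := insertedWilsonAction_stack_negReflect ρ hρ (Subgroup.one_mem _) ν hν 0 0 U
  rwa [inv_one, stackInsertion_one, stackInsertion_one, insertedWilsonAction_one,
    insertedWilsonAction_one] at h

variable [MeasurableSpace G] [BorelSpace G] (β : ℝ)

omit [NeZero d] in
/-- **Opposite twists on homologous stacks cancel** (Kanazawa 2009, Lemma 1, eq. (11):
`⟨𝒪^{[k]}[𝒱] 𝒪^{[k']}[𝒱']⟩ = ⟨𝒪^{[k+k']}[𝒱]⟩` for homologous `𝒱, 𝒱'`, "by iterating the
redefinition of variables `U → z^{k'} U` to bring `𝒱'` to `𝒱`"; here `k' = -k`): the partition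
function with a `z`-stack at height `a + 1` and a `z⁻¹`-stack at height `a` of the same plane
equals the untwisted one (one coboundary move, central `z`).
[cite: Kanazawa2008, §2 Lemma 1 eq. (11)] -/
theorem insertedPartitionFunction_stack_mul_inv_stack {z : G} (hz : z ∈ Subgroup.center G)
    (q : {p : Fin d × Fin d // p.1 < p.2}) (a b : ZMod L) :
    insertedPartitionFunction ρ β L
        (fun p => stackInsertion z q (a + 1) b p * stackInsertion z⁻¹ q a b p) =
      insertedPartitionFunction ρ β L (fun _ : Plaquette d L => (1 : G)) := by
  have hc : ∀ e : Edge d L,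
      (if e.2 = q.1.2 ∧ e.1 q.1.1 = a + 1 ∧ e.1 q.1.2 = b then z⁻¹⁻¹ else (1 : G)) ∈
        Subgroup.center G := by
    intro e
    split_ifs
    · rw [inv_inv]; exact hz
    · exact Subgroup.one_mem _
  rw [← insertedPartitionFunction_mul_coboundary ρ β hc
    (fun p => stackInsertion z q (a + 1) b p * stackInsertion z⁻¹ q a b p)]
  congr 1
  funext p
  rw [mul_assoc, stackInsertion_mul_coboundary_fst z⁻¹ q a b p,
    stackInsertion_mul_stackInsertion_inv]

end Stacks

/-! ## The inequality -/

section Main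

variable {d L N : ℕ} [NeZero d] [NeZero L] {G : Type*} [Group G] [TopologicalSpace G]
  [IsTopologicalGroup G] [CompactSpace G] [MeasurableSpace G] [BorelSpace G]
  (ρ : G →* Matrix (Fin N) (Fin N) ℂ) (β : ℝ)

/-- **The twisted partition function is bounded by the untwisted one** (Kanazawa 2009, §2,
Lemma 2, eq. (17): `0 ≤ ⟨𝒪^{[k]}[𝒱]⟩ = Z^{[k]}_Λ/Z_Λ ≤ 1`, stated there for `SU(N)` and proved by
reflection positivity in hyperplanes through sites; the same proof is carried out here for a
compact group): on the torus `(ℤ/Lℤ)^d` with `L` even, for a compact group `G`, a continuous matrix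
representation `ρ`, every real `β`, every central `z` and every plane `q = (0, ν)`,
`Z_{β,L}(z; q) ≤ Z_{β,L}(1; q)`, i.e. the vortex free energy `F_v = -log (Z(z; q)/Z(1; q))` is
`≥ 0`.
[cite: Kanazawa2008, §2 Lemma 2 eq. (17)] -/
theorem twistedPartitionFunction_le_untwisted (hL : Even L) (hρ : Continuous ρ) {z : G}
    (hz : z ∈ Subgroup.center G) (ν : Fin d) (hν : (0 : Fin d) < ν) :
    twistedPartitionFunction ρ β L z ⟨(0, ν), hν⟩ ≤
      twistedPartitionFunction ρ β L 1 ⟨(0, ν), hν⟩ := by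
  haveI : Fact (1 < L) := ⟨by
    obtain ⟨r, hr⟩ := hL
    have := NeZero.ne L
    omega⟩
  -- the two stacks: `t` (twist `z` at `x_0 = 0`) and its reflection `t'` (`z⁻¹` at `x_0 = -1`)
  set t : Plaquette d L → G := stackInsertion z ⟨(0, ν), hν⟩ 0 0 with ht
  set t' : Plaquette d L → G := stackInsertion z⁻¹ ⟨(0, ν), hν⟩ (-1) 0 with ht'
  set Zt : ℝ := insertedPartitionFunction ρ β L t with hZt_def
  set Z1 : ℝ := insertedPartitionFunction ρ β L (fun _ : Plaquette d L => (1 : G)) with hZ1_def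
  have hZ1 : twistedPartitionFunction ρ β L 1 ⟨(0, ν), hν⟩ = Z1 := by
    rw [twistedPartitionFunction_eq_at, twistedPartitionFunctionAt_eq_inserted, stackInsertion_one]
  rw [hZ1]
  change Zt ≤ Z1
  have hZt_pos : 0 < Zt := insertedPartitionFunction_pos ρ hρ β t
  have hZ1_pos : 0 < Z1 := insertedPartitionFunction_pos ρ hρ β _
  -- the reflected stack has the same partition function (`Z(z⁻¹) = Z(z)`, any stack position)
  have hZt' : insertedPartitionFunction ρ β L t' = Zt := by
    rw [ht', ← twistedPartitionFunctionAt_eq_inserted,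
      twistedPartitionFunctionAt_eq ρ β (Subgroup.inv_mem _ hz),
      twistedPartitionFunction_inv ρ β hρ hz]
    rfl
  -- Step 3: the two opposite stacks cancel
  have hZtt' : insertedPartitionFunction ρ β L (fun p => t p * t' p) = Z1 := by
    have h := insertedPartitionFunction_stack_mul_inv_stack ρ β hz ⟨(0, ν), hν⟩ (-1 : ZMod L) 0
    rwa [neg_add_cancel] at h
  -- the stacks are disjoint (`0 ≠ -1` in `ℤ/Lℤ`, `L ≥ 2`), so `S_t + S_t' = S_{tt'} + S`
  have h01 : (0 : ZMod L) ≠ -1 := fun h => by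
    have h1 : (1 : ZMod L) = 0 :=
      calc (1 : ZMod L) = 0 + 1 := (zero_add 1).symm
        _ = -1 + 1 := by rw [← h]
        _ = 0 := neg_add_cancel 1
    exact one_ne_zero h1
  have hsum : ∀ U : GaugeConfig d L G, insertedWilsonAction ρ t U + insertedWilsonAction ρ t' U =
      insertedWilsonAction ρ (fun p => t p * t' p) U + wilsonAction ρ U := fun U => by
    rw [← insertedWilsonAction_one ρ U]
    exact insertedWilsonAction_stack_add_stack ρ z z⁻¹ ⟨(0, ν), hν⟩ h01 0 U
  -- Step 2: `S_t(Θ'U) = S_t'(U)` and `S(Θ'U) = S(U)`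
  have hreft : ∀ U : GaugeConfig d L G,
      insertedWilsonAction ρ t U.negReflect = insertedWilsonAction ρ t' U := fun U => by
    rw [ht, ht', insertedWilsonAction_stack_negReflect ρ hρ hz ν hν 0 0 U, zero_add]
  have hrefS : ∀ U : GaugeConfig d L G, wilsonAction ρ U.negReflect = wilsonAction ρ U :=
    fun U => wilsonAction_negReflect ρ hρ ν hν U
  -- Step 1: the observable `F = exp(-β S_t) / exp(-β S)` and the real RP observable `Z1 F - Zt`
  set F : GaugeConfig d L G → ℝ := fun U =>
    Real.exp (β * (wilsonAction ρ U - insertedWilsonAction ρ t U)) with hF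
  set Fc : GaugeConfig d L G → ℂ := fun U => ((Z1 * F U - Zt : ℝ) : ℂ) with hFc
  have hw : ∀ U : GaugeConfig d L G, Real.exp (-β * wilsonAction ρ U) =
      Real.exp (-(β * insertedWilsonAction ρ (fun _ : Plaquette d L => (1 : G)) U)) := fun U => by
    rw [insertedWilsonAction_one, neg_mul]
  have hwF : ∀ U : GaugeConfig d L G, Real.exp (-β * wilsonAction ρ U) * F U =
      Real.exp (-(β * insertedWilsonAction ρ t U)) := fun U => by
    change Real.exp _ * Real.exp _ = _
    rw [← Real.exp_add]
    congr 1
    ring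
  have hwF' : ∀ U : GaugeConfig d L G, Real.exp (-β * wilsonAction ρ U) * F U.negReflect =
      Real.exp (-(β * insertedWilsonAction ρ t' U)) := fun U => by
    change Real.exp _ * Real.exp (β * (wilsonAction ρ U.negReflect -
      insertedWilsonAction ρ t U.negReflect)) = _
    rw [hreft, hrefS, ← Real.exp_add]
    congr 1
    ring
  have hwFF' : ∀ U : GaugeConfig d L G, Real.exp (-β * wilsonAction ρ U) * (F U.negReflect * F U) =
      Real.exp (-(β * insertedWilsonAction ρ (fun p => t p * t' p) U)) := fun U => by
    change Real.exp _ * (Real.exp (β * (wilsonAction ρ U.negReflect -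
      insertedWilsonAction ρ t U.negReflect)) * Real.exp _) = _
    rw [hreft, hrefS, ← Real.exp_add, ← Real.exp_add]
    congr 1
    linear_combination (-β) * hsum U
  -- hypotheses of the reflection-positivity theorem
  have hFm : Measurable Fc := by
    have hFr : Measurable F := Real.measurable_exp.comp
      (((WilsonRP.measurable_wilsonAction ρ hρ).sub
        (measurable_insertedWilsonAction ρ hρ t)).const_mul β)
    exact Complex.measurable_ofReal.comp ((hFr.const_mul Z1).sub_const Zt)
  set B : ℝ := 2 * N * Fintype.card (Plaquette d L) with hB
  have hFbd : ∀ U : GaugeConfig d L G, |F U| ≤ Real.exp (|β| * B + |β| * B) := fun U => by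
    rw [abs_of_pos (Real.exp_pos _)]
    refine Real.exp_le_exp.2 ?_
    have h1 : β * wilsonAction ρ U ≤ |β| * B := by
      rw [← insertedWilsonAction_one]
      calc β * insertedWilsonAction ρ (fun _ : Plaquette d L => (1 : G)) U
          ≤ |β * insertedWilsonAction ρ (fun _ : Plaquette d L => (1 : G)) U| := le_abs_self _
        _ = |β| * |insertedWilsonAction ρ (fun _ : Plaquette d L => (1 : G)) U| := abs_mul _ _
        _ ≤ |β| * B :=
            mul_le_mul_of_nonneg_left (abs_insertedWilsonAction_le ρ hρ _ U) (abs_nonneg _)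
    have h2 : -(β * insertedWilsonAction ρ t U) ≤ |β| * B := by
      calc -(β * insertedWilsonAction ρ t U) ≤ |β * insertedWilsonAction ρ t U| := neg_le_abs _
        _ = |β| * |insertedWilsonAction ρ t U| := abs_mul _ _
        _ ≤ |β| * B :=
            mul_le_mul_of_nonneg_left (abs_insertedWilsonAction_le ρ hρ _ U) (abs_nonneg _)
    calc β * (wilsonAction ρ U - insertedWilsonAction ρ t U)
        = β * wilsonAction ρ U + -(β * insertedWilsonAction ρ t U) := by ring
      _ ≤ |β| * B + |β| * B := add_le_add h1 h2
  have hFcb : ∀ U : GaugeConfig d L G, ‖Fc U‖ ≤ Z1 * Real.exp (|β| * B + |β| * B) + Zt :=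
      fun U => by
    change ‖((Z1 * F U - Zt : ℝ) : ℂ)‖ ≤ _
    rw [Complex.norm_real, Real.norm_eq_abs]
    calc |Z1 * F U - Zt| ≤ |Z1 * F U| + |Zt| := abs_sub _ _
      _ = Z1 * |F U| + Zt := by rw [abs_mul, abs_of_pos hZ1_pos, abs_of_pos hZt_pos]
      _ ≤ Z1 * Real.exp (|β| * B + |β| * B) + Zt := by
          have := hFbd U
          nlinarith [hZ1_pos.le]
  -- `F` is an observable of the links of the stack plaquettes, all in the closed positive half
  have hE : ∀ e : Edge d L, IsSitePosEdge e ∨ IsSharedEdge e →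
      e ∈ ((sitePosEdges ∪ sharedEdges : Finset (Edge d L)) : Set (Edge d L)) := fun e he => by
    rw [Finset.coe_union, Set.mem_union, Finset.mem_coe, Finset.mem_coe, mem_sitePosEdges,
      mem_sharedEdges]
    exact he
  have hdep : DependsOn Fc ((sitePosEdges ∪ sharedEdges : Finset (Edge d L)) : Set (Edge d L)) := by
    intro U V hUV
    suffices h : wilsonAction ρ U - insertedWilsonAction ρ t U =
        wilsonAction ρ V - insertedWilsonAction ρ t V by
      change ((Z1 * Real.exp (β * (wilsonAction ρ U - insertedWilsonAction ρ t U)) - Zt : ℝ) : ℂ) =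
        ((Z1 * Real.exp (β * (wilsonAction ρ V - insertedWilsonAction ρ t V)) - Zt : ℝ) : ℂ)
      rw [h]
    rw [← insertedWilsonAction_one ρ U, ← insertedWilsonAction_one ρ V]
    unfold insertedWilsonAction
    rw [← Finset.sum_sub_distrib, ← Finset.sum_sub_distrib]
    refine Finset.sum_congr rfl fun p _ => ?_
    by_cases hp : p.2 = ⟨(0, ν), hν⟩ ∧ p.1 0 = 0 ∧ p.1 ν = 0
    · have htp : t p = z := if_pos hp
      have hpos : IsSitePosPlaq p := by
        have h1 : p.2.1.1 = 0 := by rw [hp.1]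
        unfold IsSitePosPlaq
        rw [if_pos h1, hp.2.1, ZMod.val_zero]
        have : 1 < L := Fact.out
        omega
      obtain ⟨e1, e2, e3, e4⟩ := edges_of_isSitePosPlaq hL hpos
      have u1 := hUV _ (hE _ e1)
      have u2 := hUV _ (hE _ e2)
      have u3 := hUV _ (hE _ e3)
      have u4 := hUV _ (hE _ e4)
      simp only [htp, plaquetteHolonomy, u1, u2, u3, u4]
    · have htp : t p = 1 := if_neg hp
      simp [htp]
  -- reflection positivity through sites, applied to `Fc`
  have hRP := integral_siteIntegrand_nonneg ρ hL hρ β hFm hFcb hdep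
  have hg : ∀ U : GaugeConfig d L G,
      (Real.exp (-β * wilsonAction ρ U) : ℂ) * (conj (Fc U.negReflect) * Fc U) =
        ((Z1 ^ 2 * Real.exp (-(β * insertedWilsonAction ρ (fun p => t p * t' p) U)) -
            Z1 * Zt * Real.exp (-(β * insertedWilsonAction ρ t' U)) -
            Z1 * Zt * Real.exp (-(β * insertedWilsonAction ρ t U)) +
            Zt ^ 2 * Real.exp (-(β * insertedWilsonAction ρ (fun _ : Plaquette d L => (1 : G)) U))
          : ℝ) : ℂ) := fun U => by
    rw [← hwFF' U, ← hwF' U, ← hwF U, ← hw U]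
    simp only [hFc, Complex.conj_ofReal]
    push_cast
    ring
  simp_rw [hg] at hRP
  rw [integral_complex_ofReal] at hRP
  have hI := Complex.zero_le_real.1 hRP
  have iT : ∀ (c : ℝ) (s : Plaquette d L → G), Integrable
      (fun U : GaugeConfig d L G => c * Real.exp (-(β * insertedWilsonAction ρ s U)))
      (LatticeRP.piMeasure (haarProbability G) : Measure (GaugeConfig d L G)) := fun c s =>
    (integrable_exp_insertedWilsonAction ρ hρ β s).const_mul c
  have iAB : Integrable (fun U : GaugeConfig d L G =>
      Z1 ^ 2 * Real.exp (-(β * insertedWilsonAction ρ (fun p => t p * t' p) U)) -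
        Z1 * Zt * Real.exp (-(β * insertedWilsonAction ρ t' U)))
      (LatticeRP.piMeasure (haarProbability G) : Measure (GaugeConfig d L G)) :=
    (iT _ _).sub (iT _ _)
  have iABC : Integrable (fun U : GaugeConfig d L G =>
      Z1 ^ 2 * Real.exp (-(β * insertedWilsonAction ρ (fun p => t p * t' p) U)) -
        Z1 * Zt * Real.exp (-(β * insertedWilsonAction ρ t' U)) -
        Z1 * Zt * Real.exp (-(β * insertedWilsonAction ρ t U)))
      (LatticeRP.piMeasure (haarProbability G) : Measure (GaugeConfig d L G)) :=
    iAB.sub (iT _ _)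
  rw [integral_add iABC (iT _ _), integral_sub iAB (iT _ _), integral_sub (iT _ _) (iT _ _),
    integral_const_mul, integral_const_mul, integral_const_mul, integral_const_mul] at hI
  change 0 ≤ Z1 ^ 2 * insertedPartitionFunction ρ β L (fun p => t p * t' p) -
      Z1 * Zt * insertedPartitionFunction ρ β L t' - Z1 * Zt * Zt + Zt ^ 2 * Z1 at hI
  rw [hZtt', hZt'] at hI
  -- `0 ≤ Z1³ - Z1 Zt²` with `Z1, Zt > 0` gives `Zt ≤ Z1`
  have hsq : 0 ≤ Z1 ^ 2 - Zt ^ 2 :=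
    (mul_nonneg_iff_of_pos_left hZ1_pos).1 (by nlinarith [hI])
  nlinarith [hsq, hZ1_pos, hZt_pos]

/-- **Corollary**: `Z_{β,L}(z; (0, ν)) ≤ Z_{β,L}` (the untwisted Wilson partition function).
[cite: Kanazawa2008, §2 Lemma 2 eq. (17)] -/
theorem twistedPartitionFunction_le_partitionFunction (hL : Even L) (hρ : Continuous ρ) {z : G}
    (hz : z ∈ Subgroup.center G) (ν : Fin d) (hν : (0 : Fin d) < ν) :
    twistedPartitionFunction ρ β L z ⟨(0, ν), hν⟩ ≤
      (partitionFunction (d := d) (L := L) ρ β).toReal := by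
  rw [← twistedPartitionFunction_one ρ hρ β ⟨(0, ν), hν⟩]
  exact twistedPartitionFunction_le_untwisted ρ β hL hρ hz ν hν

/-- The **vortex free energy is non-negative**: `Z(z; q)/Z(1; q) ∈ (0, 1]`, i.e.
`0 ≤ F_v = -log (Z(z; q)/Z(1; q)) < ∞` (Kanazawa 2009, eq. (17): `0 ≤ ⟨𝒪^{[k]}[𝒱]⟩ ≤ 1`, with the
left inequality strict). [cite: Kanazawa2008, §2 Lemma 2 eq. (17)] -/
theorem twistedPartitionFunction_ratio_mem_Ioc (hL : Even L) (hρ : Continuous ρ) {z : G}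
    (hz : z ∈ Subgroup.center G) (ν : Fin d) (hν : (0 : Fin d) < ν) :
    twistedPartitionFunction ρ β L z ⟨(0, ν), hν⟩ / twistedPartitionFunction ρ β L 1 ⟨(0, ν), hν⟩ ∈
      Set.Ioc (0 : ℝ) 1 := by
  have h1 : 0 < twistedPartitionFunction ρ β L 1 ⟨(0, ν), hν⟩ :=
    twistedPartitionFunction_pos ρ hρ β 1 _
  exact ⟨div_pos (twistedPartitionFunction_pos ρ hρ β z _) h1,
    (div_le_one h1).2 (twistedPartitionFunction_le_untwisted ρ β hL hρ hz ν hν)⟩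

end Main

/-! ## All planes: relabelling the axes

The site reflection of this tree is in the `0`-direction, so the argument above needs the twisted
plane to contain the `0`-axis. For a plane `(μ, ν)` with `0 < μ < ν` the transposition of the axes
`0 ↔ μ` (a relabelling of the link variables, `TwistedPartitionFunction.configTranspose`, which
preserves the product Haar measure) carries the `(μ, ν)`-stack to the `(0, ν)`-stack with the same
twist: the orientation of the twisted plaquettes is preserved (`μ < ν` and `0 < ν`), the other
plaquettes are permuted up to orientation, which the bookkeeping by symmetric functions of ordered
pairs of directions (`TwistedPartitionFunction.sum_plaquette_transpose`) absorbs. -/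

section AllPlanes

variable {d L N : ℕ} {G : Type*} [Group G]

/-- Coordinates other than the two transposed ones are unchanged. [folklore] -/
private theorem siteTranspose_apply_of_ne {μ ν k : Fin d} (hkμ : k ≠ μ) (hkν : k ≠ ν)
    (x : Site d L) : siteTranspose μ ν x k = x k := by
  simp [siteTranspose, Equiv.swap_apply_of_ne_of_ne hkμ hkν]

/-- Reversing the orientation of a plaquette inverts its holonomy. [folklore] -/
private theorem plaquetteHolonomy_reverse' (U : GaugeConfig d L G) (x : Site d L) (i j : Fin d) :
    plaquetteHolonomy U x j i = (plaquetteHolonomy U x i j)⁻¹ := by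
  simp only [plaquetteHolonomy, mul_inv_rev, inv_inv, mul_assoc]

variable [NeZero d]

/-- Transporting the ordered insertion of the `(0, ν)`-stack along the transposition `0 ↔ μ`
(`0 < μ < ν`) gives the `(μ, ν)`-stack insertion with the same twist. [folklore] -/
private theorem orderedInsertion_transpose_zero (z : G) {μ ν : Fin d} (hμ : (0 : Fin d) < μ)
    (hμν : μ < ν) (a b : ZMod L) (p : Plaquette d L) :
    orderedInsertion z 0 ν a b (siteTranspose 0 μ p.1) (Equiv.swap 0 μ p.2.1.1)
        (Equiv.swap 0 μ p.2.1.2) = stackInsertion z ⟨(μ, ν), hμν⟩ a b p := by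
  obtain ⟨x, ⟨⟨i, j⟩, hij⟩⟩ := p
  have hν0 : ν ≠ 0 := (hμ.trans hμν).ne'
  have hνμ : ν ≠ μ := hμν.ne'
  unfold orderedInsertion stackInsertion
  simp only [Subtype.mk.injEq, Prod.mk.injEq, siteTranspose_apply_left,
    siteTranspose_apply_of_ne hν0 hνμ, Equiv.swap_apply_eq_iff, Equiv.swap_apply_left,
    Equiv.swap_apply_of_ne_of_ne hν0 hνμ]
  have hB : ¬ ((i = ν ∧ j = μ) ∧ x μ = a ∧ x ν = b) := fun h => by
    obtain ⟨⟨rfl, rfl⟩, -⟩ := h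
    exact lt_asymm hij hμν
  by_cases hA : (i = μ ∧ j = ν) ∧ x μ = a ∧ x ν = b
  · rw [if_pos hA, if_pos hA]
  · rw [if_neg hA, if_neg hB, if_neg hA]

variable [NeZero L] [TopologicalSpace G] [IsTopologicalGroup G] [CompactSpace G]
  (ρ : G →* Matrix (Fin N) (Fin N) ℂ)

/-- **The twisted action under the relabelling `0 ↔ μ`** (`0 < μ < ν`): the `(μ, ν)`-twisted action
of the transposed configuration is the `(0, ν)`-twisted action of the configuration (same twist,
same stack coordinates). [folklore] -/
private theorem insertedWilsonAction_stack_configTranspose_zero (hρ : Continuous ρ) (z : G)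
    {μ ν : Fin d} (hμ : (0 : Fin d) < μ) (hμν : μ < ν) (a b : ZMod L) (U : GaugeConfig d L G) :
    insertedWilsonAction ρ (stackInsertion z ⟨(μ, ν), hμν⟩ a b) (configTranspose 0 μ U) =
      insertedWilsonAction ρ (stackInsertion z ⟨(0, ν), hμ.trans hμν⟩ a b) U := by
  set g : Site d L → Fin d → Fin d → ℝ := fun y k l =>
    (N : ℝ) - (ρ (orderedInsertion z 0 ν a b y k l * plaquetteHolonomy U y k l)).trace.re with hg
  have hsymm : ∀ y k l, g y k l = g y l k := by
    intro y k l
    simp only [hg]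
    rw [orderedInsertion_swap (hμ.trans hμν).ne z a b y k l, plaquetteHolonomy_reverse' U y k l,
      re_trace_inv_mul_inv ρ hρ]
  calc insertedWilsonAction ρ (stackInsertion z ⟨(μ, ν), hμν⟩ a b) (configTranspose 0 μ U)
      = ∑ p : Plaquette d L, g (siteTranspose 0 μ p.1) (Equiv.swap 0 μ p.2.1.1)
          (Equiv.swap 0 μ p.2.1.2) := by
        unfold insertedWilsonAction
        refine Finset.sum_congr rfl fun p _ => ?_
        simp only [hg]
        rw [plaquetteHolonomy_configTranspose, orderedInsertion_transpose_zero z hμ hμν]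
    _ = ∑ p : Plaquette d L, g p.1 p.2.1.1 p.2.1.2 := sum_plaquette_transpose g hsymm 0 μ
    _ = insertedWilsonAction ρ (stackInsertion z ⟨(0, ν), hμ.trans hμν⟩ a b) U := by
        unfold insertedWilsonAction
        refine Finset.sum_congr rfl fun p _ => ?_
        simp only [hg]
        rw [orderedInsertion_plaquette (hμ.trans hμν)]

variable [MeasurableSpace G] [BorelSpace G] (β : ℝ)

/-- `Z_{a,b}(z; (μ, ν)) = Z_{a,b}(z; (0, ν))` for `0 < μ < ν` and continuous `ρ` (any `z`): change
of variables along the transposition `0 ↔ μ`. [folklore] -/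
private theorem twistedPartitionFunctionAt_eq_transpose_zero (hρ : Continuous ρ) (z : G)
    {μ ν : Fin d} (hμ : (0 : Fin d) < μ) (hμν : μ < ν) (a b : ZMod L) :
    twistedPartitionFunctionAt ρ β L z ⟨(μ, ν), hμν⟩ a b =
      twistedPartitionFunctionAt ρ β L z ⟨(0, ν), hμ.trans hμν⟩ a b := by
  rw [twistedPartitionFunctionAt_eq_inserted, twistedPartitionFunctionAt_eq_inserted]
  unfold insertedPartitionFunction
  calc ∫ U : GaugeConfig d L G, Real.exp (-(β * insertedWilsonAction ρ
          (stackInsertion z ⟨(μ, ν), hμν⟩ a b) U))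
          ∂(Measure.pi fun _ : Edge d L => haarProbability G)
      = ∫ U : GaugeConfig d L G, Real.exp (-(β * insertedWilsonAction ρ
          (stackInsertion z ⟨(μ, ν), hμν⟩ a b) (configTransposeEquiv 0 μ U)))
          ∂(Measure.pi fun _ : Edge d L => haarProbability G) :=
        ((measurePreserving_configTransposeEquiv 0 μ).integral_comp'
          (fun V : GaugeConfig d L G => Real.exp (-(β * insertedWilsonAction ρ
            (stackInsertion z ⟨(μ, ν), hμν⟩ a b) V)))).symm
    _ = ∫ U : GaugeConfig d L G, Real.exp (-(β * insertedWilsonAction ρ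
          (stackInsertion z ⟨(0, ν), hμ.trans hμν⟩ a b) U))
          ∂(Measure.pi fun _ : Edge d L => haarProbability G) := by
        simp only [configTransposeEquiv_apply,
          insertedWilsonAction_stack_configTranspose_zero ρ hρ z hμ hμν]

/-- **`Z(z; (μ, ν)) = Z(z; (0, ν))` for `0 < μ < ν`** (every real `β`, every `z`, continuous `ρ`): the
twisted partition function of a plane not containing the `0`-axis equals the one of the plane `(0, ν)`,
by the relabelling `0 ↔ μ` of the axes (a measure-preserving change of the link variables carrying the
`(μ, ν)`-stack to the `(0, ν)`-stack with the same twist) — the symmetry behind «for every plane» in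
Kanazawa's Lemma 2. [cite: Kanazawa2008, §2 Lemma 2 eq. (17)] -/
theorem twistedPartitionFunction_eq_transpose_zero (hρ : Continuous ρ) (z : G) {μ ν : Fin d}
    (hμ : (0 : Fin d) < μ) (hμν : μ < ν) :
    twistedPartitionFunction ρ β L z ⟨(μ, ν), hμν⟩ =
      twistedPartitionFunction ρ β L z ⟨(0, ν), hμ.trans hμν⟩ := by
  rw [twistedPartitionFunction_eq_at, twistedPartitionFunction_eq_at,
    twistedPartitionFunctionAt_eq_transpose_zero ρ β hρ z hμ hμν]

/-- **`Z(z; q) ≤ Z(1; q)` for every plane `q`** (Kanazawa 2009, §2, Lemma 2, eq. (17), for a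
compact group): on the torus `(ℤ/Lℤ)^d` with `L` even, for a compact group `G`, a continuous
matrix representation `ρ`, every real `β`, every central `z` and every plane `q = (μ, ν)`,
`Z_{β,L}(z; q) ≤ Z_{β,L}(1; q)` (planes containing the `0`-axis:
`twistedPartitionFunction_le_untwisted`; the others are carried there by the relabelling `0 ↔ μ` of
the axes). [cite: Kanazawa2008, §2 Lemma 2 eq. (17)] -/
theorem twistedPartitionFunction_le_untwisted_plane (hL : Even L) (hρ : Continuous ρ)
    {z : G} (hz : z ∈ Subgroup.center G) (q : {p : Fin d × Fin d // p.1 < p.2}) :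
    twistedPartitionFunction ρ β L z q ≤ twistedPartitionFunction ρ β L 1 q := by
  obtain ⟨⟨μ, ν⟩, hμν⟩ := q
  by_cases hμ : μ = 0
  · subst hμ
    exact twistedPartitionFunction_le_untwisted ρ β hL hρ hz ν hμν
  · have hμ' : (0 : Fin d) < μ := by
      rw [Fin.lt_def, Fin.val_zero]
      exact Nat.pos_of_ne_zero fun h => hμ (Fin.ext (by rw [h, Fin.val_zero]))
    rw [twistedPartitionFunction_eq_at, twistedPartitionFunction_eq_at,
      twistedPartitionFunctionAt_eq_transpose_zero ρ β hρ z hμ' hμν,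
      twistedPartitionFunctionAt_eq_transpose_zero ρ β hρ 1 hμ' hμν]
    exact twistedPartitionFunction_le_untwisted ρ β hL hρ hz ν (hμ'.trans hμν)

/-- **`Z(z; q) ≤ Z` for every plane `q`**: the twisted partition function is bounded by the
(untwisted) Wilson partition function. [cite: Kanazawa2008, §2 Lemma 2 eq. (17)] -/
theorem twistedPartitionFunction_le_partitionFunction_plane (hL : Even L)
    (hρ : Continuous ρ) {z : G} (hz : z ∈ Subgroup.center G)
    (q : {p : Fin d × Fin d // p.1 < p.2}) :
    twistedPartitionFunction ρ β L z q ≤ (partitionFunction (d := d) (L := L) ρ β).toReal := by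
  rw [← twistedPartitionFunction_one ρ hρ β q]
  exact twistedPartitionFunction_le_untwisted_plane ρ β hL hρ hz q

end AllPlanes


end

end Literature.MathematicalPhysics.QuantumFieldTheory
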